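import Mathlib
import HarnessLib
import Summits.Ventures.LatticeQCDFlow.Scaling.WilsonIdentityFlowLaw
import Summits.Ventures.LatticeQCDFlow.Scaling.U1IdentityFlowVolumeLaw
import Summits.Ventures.LatticeQCDFlow.Scaling.TiltAcceptanceCouplingMonotone

/-!
# LatticeQCDFlow / Scaling — the ACCEPTANCE ITSELF of the untrained (identity-flow) exact sampler
# is non-increasing in the coupling: every Wilson lattice gauge theory (`β ≥ 0`) and the
# factorised 2-d U(1) model (in `|β|`)

HONEST FRAMING: exact (Metropolis-corrected) sampling algorithms for lattice gauge theory;
figures of merit are autocorrelation/cost numbers at stated couplings and volumes; no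
continuum-physics claim.

Venture `LatticeQCDFlow` (cell pub-lqcd), topic `Scaling`; FANOUT row 3 (`s0-u1-a`, S0-B
implementation A, GEN-17).  NEW WORK of the cell, not a published result; NO definition is
introduced.  Row 3's identity-flow laws pin the untrained exact sampler (proposals i.i.d. from the
reference law, Metropolis-corrected against the Boltzmann tilt) by the sandwich
`(8/9)·Z(β)²/Z(2β) ≤ acc(β) ≤ Z(β/2)²/Z(β)` (`Scaling/WilsonIdentityFlowLaw`,
`Scaling/U1IdentityFlowVolumeLaw`, imported) and GEN-16 proved both ENVELOPES non-increasing in the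
coupling (`Scaling/IdentityFlowCouplingMonotone`), leaving the acceptance itself open.  The general
tilt theorem `Scaling/TiltAcceptanceCouplingMonotone.tiltIMH_meanAccept_antitoneOn` (imported;
Chebyshev's integral inequality, no differentiation) closes it:

* §3 WILSON lattice gauge theory — every compact `G`, continuous `ρ`, `d`, `L`, reference
  probability law `μ`, target `p_β = e^{−βS}/Z_μ(β)`: `wilsonIdentityFlow_meanAccept_eq_ratio`
  (the acceptance `∫∫ min(p_β(U), p_β(U′)) dμ dμ` of `WilsonIdentityFlowLaw` in ratio form),
  **`wilsonIdentityFlow_meanAccept_antitoneOn`** (NON-INCREASING on `[0, ∞)`),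
  **`wilsonIdentityFlow_meanAccept_monotoneOn`** (non-decreasing on `(−∞, 0]`) and the product-Haar
  form **`wilsonIdentityFlow_meanAccept_antitoneOn_haar`** (normalisation by theory-2's
  `partitionFunction ρ β`);
* §4 the FACTORISED 2-d U(1) model of `U1IdentityFlowVolumeLaw` (`V = |ι|` independent plaquette
  angles on `(0, 2π]`, product-Haar proposals; the tilt statistic is `T = Σᵢ cos θᵢ`):
  `u1IdentityFlow_meanAccept_eq_ratio`, `u1IdentityFlow_tilt_facts`,
  **`u1IdentityFlow_meanAccept_antitoneOn`** (`acc_V` NON-INCREASING on `[0, ∞)`) and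
  **`u1IdentityFlow_meanAccept_monotoneOn`** (non-decreasing on `(−∞, 0]`), every finite `ι`.

Reading (value-free; no number of ours is computed or implied): the untrained exact sampler of a
Wilson theory accepts everything at `β = 0` and monotonically less as the coupling grows — the
acceptance column of a zero-training LEADERBOARD row at one `β` bounds the same row at every larger
`β` (same `L`), exactly as GEN-16 showed for its ESS column and its ceiling.  NOT CLAIMED: strict
decrease; the torus-constrained U(1) model; trained flows; any value at the cell's `(β, L)`;
nothing re-scored, SEALED.md untouched.
-/

noncomputable section

namespace Summit.Ventures.LatticeQCDFlow.Theory2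

open MeasureTheory Real Set

/-! ## §3 Wilson lattice gauge theory: the untrained sampler's acceptance is non-increasing in `β ≥ 0` -/

section Wilson

open Literature.MathematicalPhysics.QuantumFieldTheory

variable {d L N : ℕ} [NeZero L] {G : Type*} [Group G] [TopologicalSpace G] [IsTopologicalGroup G]
  [CompactSpace G] [MeasurableSpace G] [BorelSpace G] (ρ : G →* Matrix (Fin N) (Fin N) ℂ)
  (μ : Measure (GaugeConfig d L G)) [IsProbabilityMeasure μ]

/-- The Wilson acceptance integral in the ratio form of §2 (`q ≡ 1`, `T = −S`). [ours] -/
theorem wilsonIdentityFlow_meanAccept_eq_ratio (hρ : Continuous ρ) (β : ℝ) :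
    ∫ U, ∫ U', min (Real.exp (-β * wilsonAction ρ U) / ∫ V, Real.exp (-β * wilsonAction ρ V) ∂μ)
        (Real.exp (-β * wilsonAction ρ U') / ∫ V, Real.exp (-β * wilsonAction ρ V) ∂μ) ∂μ ∂μ
      = (∫ U, ∫ U', (1 : ℝ) * 1 * min (Real.exp (β * -wilsonAction ρ U))
            (Real.exp (β * -wilsonAction ρ U')) ∂μ ∂μ)
          / ∫ V, 1 * Real.exp (β * -wilsonAction ρ V) ∂μ := by
  have hZ : 0 ≤ ∫ V, Real.exp (-β * wilsonAction ρ V) ∂μ := (wilsonZI_pos ρ μ hρ β).le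
  simp_rw [one_mul, mul_neg, ← neg_mul, min_div_div_right hZ, integral_div]

/-- **THE ACCEPTANCE OF THE UNTRAINED WILSON SAMPLER IS NON-INCREASING IN THE COUPLING**: for every
compact gauge group `G`, continuous representation `ρ`, dimension `d`, torus size `L` and reference
probability law `μ`, the equilibrium acceptance `∫∫ min(p_β(U), p_β(U′)) dμ dμ`,
`p_β = e^{−βS}/Z_μ(β)`, of the exact sampler proposing configurations from `μ` (row 3's
`Scaling/WilsonIdentityFlowLaw`) is a non-increasing function of `β` on `[0, ∞)`. [ours] -/
theorem wilsonIdentityFlow_meanAccept_antitoneOn (hρ : Continuous ρ) :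
    AntitoneOn (fun β : ℝ => ∫ U, ∫ U',
        min (Real.exp (-β * wilsonAction ρ U) / ∫ V, Real.exp (-β * wilsonAction ρ V) ∂μ)
          (Real.exp (-β * wilsonAction ρ U') / ∫ V, Real.exp (-β * wilsonAction ρ V) ∂μ) ∂μ ∂μ)
      (Ici 0) := by
  have hint : ∀ γ : ℝ, Integrable (fun U : GaugeConfig d L G =>
      (1 : ℝ) * Real.exp (γ * -wilsonAction ρ U)) μ := fun γ => by
    simpa only [one_mul, mul_neg, neg_mul] using integrable_exp_mul_wilsonAction ρ hρ (-γ) μ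
  have hMpos : ∀ γ : ℝ, 0 < ∫ U, (1 : ℝ) * Real.exp (γ * -wilsonAction ρ U) ∂μ := fun γ => by
    simpa only [one_mul, mul_neg, neg_mul] using wilsonZI_pos ρ μ hρ γ
  have h := tiltIMH_meanAccept_antitoneOn (ν := μ) (q := fun _ => (1 : ℝ))
    (T := fun U => -wilsonAction ρ U) (fun _ => zero_le_one) measurable_const
    (WilsonRP.measurable_wilsonAction ρ hρ).neg (fun γ _ => hint γ) (fun γ _ => hMpos γ)
  intro β hβ β' hβ' hββ'
  simp only [wilsonIdentityFlow_meanAccept_eq_ratio ρ μ hρ]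
  exact h hβ hβ' hββ'

/-- **… and non-decreasing on `(−∞, 0]`**: the untrained Wilson sampler accepts everything exactly at
`β = 0` and monotonically less away from it. [ours] -/
theorem wilsonIdentityFlow_meanAccept_monotoneOn (hρ : Continuous ρ) :
    MonotoneOn (fun β : ℝ => ∫ U, ∫ U',
        min (Real.exp (-β * wilsonAction ρ U) / ∫ V, Real.exp (-β * wilsonAction ρ V) ∂μ)
          (Real.exp (-β * wilsonAction ρ U') / ∫ V, Real.exp (-β * wilsonAction ρ V) ∂μ) ∂μ ∂μ)
      (Iic 0) := by
  have hint : ∀ γ : ℝ, Integrable (fun U : GaugeConfig d L G =>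
      (1 : ℝ) * Real.exp (γ * -wilsonAction ρ U)) μ := fun γ => by
    simpa only [one_mul, mul_neg, neg_mul] using integrable_exp_mul_wilsonAction ρ hρ (-γ) μ
  have hMpos : ∀ γ : ℝ, 0 < ∫ U, (1 : ℝ) * Real.exp (γ * -wilsonAction ρ U) ∂μ := fun γ => by
    simpa only [one_mul, mul_neg, neg_mul] using wilsonZI_pos ρ μ hρ γ
  have h := tiltIMH_meanAccept_monotoneOn (ν := μ) (q := fun _ => (1 : ℝ))
    (T := fun U => -wilsonAction ρ U) (fun _ => zero_le_one) measurable_const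
    (WilsonRP.measurable_wilsonAction ρ hρ).neg (fun γ _ => hint γ) (fun γ _ => hMpos γ)
  intro β hβ β' hβ' hββ'
  simp only [wilsonIdentityFlow_meanAccept_eq_ratio ρ μ hρ]
  exact h hβ hβ' hββ'

/-- **Product-Haar reference law** (the cell's identity flow, partition function
`partitionFunction ρ β`): the acceptance is non-increasing on `[0, ∞)`. [ours] -/
theorem wilsonIdentityFlow_meanAccept_antitoneOn_haar (hρ : Continuous ρ) :
    AntitoneOn (fun β : ℝ => ∫ U, ∫ U',
        min (Real.exp (-β * wilsonAction ρ U) / (partitionFunction (d := d) (L := L) ρ β).toReal)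
          (Real.exp (-β * wilsonAction ρ U') / (partitionFunction (d := d) (L := L) ρ β).toReal)
        ∂(Measure.pi fun _ : Edge d L => haarProbability G)
        ∂(Measure.pi fun _ : Edge d L => haarProbability G)) (Ici 0) := by
  simp_rw [partitionFunction_toReal_eq_integral ρ hρ]
  exact wilsonIdentityFlow_meanAccept_antitoneOn ρ _ hρ

end Wilson

/-! ## §4 The factorised 2-d U(1) model: `acc_V(β)` is non-increasing in `β ≥ 0` and
non-decreasing in `β ≤ 0`, for every number of plaquettes -/

section U1

open Finset
open Summit.Ventures.LatticeQCDFlow.Scoring (onePlaquetteZ onePlaquetteZ_pos)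

variable {ι : Type*} [Fintype ι]

/-- The U(1) `V`-plaquette acceptance in the ratio form of §2 (`ν = Lebesgue^{⊗V}` on `(0, 2π]^V`,
`q ≡ (2π)^{−V}`, `T = Σᵢ cos θᵢ`). [ours] -/
theorem u1IdentityFlow_meanAccept_eq_ratio (β : ℝ) :
    ∫ x, ∫ x', min ((∏ i : ι, Real.exp (β * Real.cos (x i)) / onePlaquetteZ β)
          * ∏ _i : ι, (1 / (2 * π) : ℝ))
        ((∏ i : ι, Real.exp (β * Real.cos (x' i)) / onePlaquetteZ β) * ∏ _i : ι, (1 / (2 * π) : ℝ))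
        ∂(Measure.pi fun _ : ι => volume.restrict (Ioc (0 : ℝ) (2 * π)))
        ∂(Measure.pi fun _ : ι => volume.restrict (Ioc (0 : ℝ) (2 * π)))
      = (∫ x, ∫ x', (∏ _i : ι, (1 / (2 * π) : ℝ)) * (∏ _i : ι, (1 / (2 * π) : ℝ))
            * min (Real.exp (β * ∑ i, Real.cos (x i))) (Real.exp (β * ∑ i, Real.cos (x' i)))
          ∂(Measure.pi fun _ : ι => volume.restrict (Ioc (0 : ℝ) (2 * π)))
          ∂(Measure.pi fun _ : ι => volume.restrict (Ioc (0 : ℝ) (2 * π))))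
        / ∫ x, (∏ _i : ι, (1 / (2 * π) : ℝ)) * Real.exp (β * ∑ i, Real.cos (x i))
          ∂(Measure.pi fun _ : ι => volume.restrict (Ioc (0 : ℝ) (2 * π))) := by
  set ν : Measure ℝ := volume.restrict (Ioc (0 : ℝ) (2 * π)) with hν
  set c : ℝ := ∏ _i : ι, (1 / (2 * π) : ℝ) with hc
  have hc0 : 0 < c := prod_pos fun _ _ => by positivity
  have hZ := onePlaquetteZ_pos β
  set Zv : ℝ := onePlaquetteZ β ^ Fintype.card ι with hZv
  have hZv : 0 < Zv := pow_pos hZ _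
  -- the product density is the tilt by `β Σ cos`
  have hP : ∀ x : ι → ℝ, ∏ i, Real.exp (β * Real.cos (x i)) / onePlaquetteZ β
      = Real.exp (β * ∑ i, Real.cos (x i)) / Zv := by
    intro x
    rw [prod_div_distrib, prod_const, card_univ, mul_sum, Real.exp_sum]
  -- the partition function `∫ e^{βT} dν = Z(β)^V`
  have hM : ∫ x, Real.exp (β * ∑ i, Real.cos (x i)) ∂(Measure.pi fun _ : ι => ν) = Zv := by
    have e : ∀ x : ι → ℝ, Real.exp (β * ∑ i, Real.cos (x i)) = ∏ i, Real.exp (β * Real.cos (x i)) :=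
      fun x => by rw [mul_sum, Real.exp_sum]
    simp_rw [e]
    rw [integral_fintype_prod_eq_prod (μ := fun _ : ι => ν)
      (fun (_ : ι) (θ : ℝ) => Real.exp (β * Real.cos θ)), prod_const, card_univ, hν,
      integral_Ioc_exp_mul_cos]
  have e : ∀ x x' : ι → ℝ, min ((∏ i, Real.exp (β * Real.cos (x i)) / onePlaquetteZ β) * c)
      ((∏ i, Real.exp (β * Real.cos (x' i)) / onePlaquetteZ β) * c)
      = c / Zv * min (Real.exp (β * ∑ i, Real.cos (x i))) (Real.exp (β * ∑ i, Real.cos (x' i))) := by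
    intro x x'
    rw [hP, hP, show Real.exp (β * ∑ i, Real.cos (x i)) / Zv * c
        = c / Zv * Real.exp (β * ∑ i, Real.cos (x i)) by ring,
      show Real.exp (β * ∑ i, Real.cos (x' i)) / Zv * c
        = c / Zv * Real.exp (β * ∑ i, Real.cos (x' i)) by ring,
      mul_min_of_nonneg _ _ (div_pos hc0 hZv).le]
  simp_rw [e, integral_const_mul]
  rw [hM]
  field_simp

/-- Hypotheses of §2 for the factorised U(1) model. [ours] -/
theorem u1IdentityFlow_tilt_facts :
    (Measurable fun x : ι → ℝ => ∑ i, Real.cos (x i)) ∧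
    (∀ γ : ℝ, Integrable (fun x : ι → ℝ => (∏ _i : ι, (1 / (2 * π) : ℝ))
        * Real.exp (γ * ∑ i, Real.cos (x i)))
        (Measure.pi fun _ : ι => volume.restrict (Ioc (0 : ℝ) (2 * π)))) ∧
    (∀ γ : ℝ, 0 < ∫ x, (∏ _i : ι, (1 / (2 * π) : ℝ)) * Real.exp (γ * ∑ i, Real.cos (x i))
        ∂(Measure.pi fun _ : ι => volume.restrict (Ioc (0 : ℝ) (2 * π)))) := by
  set ν : Measure ℝ := volume.restrict (Ioc (0 : ℝ) (2 * π)) with hν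
  set c : ℝ := ∏ _i : ι, (1 / (2 * π) : ℝ) with hc
  have hc0 : 0 < c := prod_pos fun _ _ => by positivity
  have e : ∀ γ (x : ι → ℝ), Real.exp (γ * ∑ i, Real.cos (x i)) = ∏ i, Real.exp (γ * Real.cos (x i)) :=
    fun γ x => by rw [mul_sum, Real.exp_sum]
  refine ⟨Finset.measurable_sum _ fun i _ => Real.measurable_cos.comp (measurable_pi_apply i),
    fun γ => ?_, fun γ => ?_⟩
  · have h : Integrable (fun x : ι → ℝ => ∏ i, Real.exp (γ * Real.cos (x i))) (Measure.pi fun _ => ν) :=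
      Integrable.fintype_prod_dep (μ := fun _ : ι => ν) fun _ => integrableOn_exp_mul_cos γ
    exact (h.const_mul c).congr (ae_of_all _ fun x => by simp only; rw [e])
  · simp_rw [e]
    rw [integral_const_mul, integral_fintype_prod_eq_prod (μ := fun _ : ι => ν)
      (fun (_ : ι) (θ : ℝ) => Real.exp (γ * Real.cos θ)), prod_const, card_univ, hν,
      integral_Ioc_exp_mul_cos]
    exact mul_pos hc0 (pow_pos (onePlaquetteZ_pos γ) _)

/-- **THE UNTRAINED 2-d U(1) SAMPLER: `acc_V(β)` IS NON-INCREASING IN `β ≥ 0`** — the equilibrium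
acceptance of product-Haar proposals against `V` independent Wilson plaquettes (row 3's
`Scaling/U1IdentityFlowVolumeLaw.u1IdentityFlow_meanAccept_mem_Icc`), for every finite plaquette
set. [ours] -/
theorem u1IdentityFlow_meanAccept_antitoneOn :
    AntitoneOn (fun β : ℝ => ∫ x, ∫ x',
        min ((∏ i : ι, Real.exp (β * Real.cos (x i)) / onePlaquetteZ β) * ∏ _i : ι, (1 / (2 * π) : ℝ))
          ((∏ i : ι, Real.exp (β * Real.cos (x' i)) / onePlaquetteZ β) * ∏ _i : ι, (1 / (2 * π) : ℝ))
        ∂(Measure.pi fun _ : ι => volume.restrict (Ioc (0 : ℝ) (2 * π)))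
        ∂(Measure.pi fun _ : ι => volume.restrict (Ioc (0 : ℝ) (2 * π)))) (Ici 0) := by
  obtain ⟨hTm, hint, hMpos⟩ := u1IdentityFlow_tilt_facts (ι := ι)
  have h := tiltIMH_meanAccept_antitoneOn
    (ν := Measure.pi fun _ : ι => volume.restrict (Ioc (0 : ℝ) (2 * π)))
    (q := fun _ => ∏ _i : ι, (1 / (2 * π) : ℝ)) (T := fun x => ∑ i, Real.cos (x i))
    (fun _ => prod_nonneg fun _ _ => by positivity) measurable_const hTm (fun γ _ => hint γ)
    (fun γ _ => hMpos γ)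
  intro β hβ β' hβ' hββ'
  simp only [u1IdentityFlow_meanAccept_eq_ratio]
  exact h hβ hβ' hββ'

/-- **… AND NON-DECREASING IN `β ≤ 0`**: the untrained U(1) sampler is perfect exactly at `β = 0`
and its acceptance falls monotonically as `|β|` grows, in either direction. [ours] -/
theorem u1IdentityFlow_meanAccept_monotoneOn :
    MonotoneOn (fun β : ℝ => ∫ x, ∫ x',
        min ((∏ i : ι, Real.exp (β * Real.cos (x i)) / onePlaquetteZ β) * ∏ _i : ι, (1 / (2 * π) : ℝ))
          ((∏ i : ι, Real.exp (β * Real.cos (x' i)) / onePlaquetteZ β) * ∏ _i : ι, (1 / (2 * π) : ℝ))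
        ∂(Measure.pi fun _ : ι => volume.restrict (Ioc (0 : ℝ) (2 * π)))
        ∂(Measure.pi fun _ : ι => volume.restrict (Ioc (0 : ℝ) (2 * π)))) (Iic 0) := by
  obtain ⟨hTm, hint, hMpos⟩ := u1IdentityFlow_tilt_facts (ι := ι)
  have h := tiltIMH_meanAccept_monotoneOn
    (ν := Measure.pi fun _ : ι => volume.restrict (Ioc (0 : ℝ) (2 * π)))
    (q := fun _ => ∏ _i : ι, (1 / (2 * π) : ℝ)) (T := fun x => ∑ i, Real.cos (x i))
    (fun _ => prod_nonneg fun _ _ => by positivity) measurable_const hTm (fun γ _ => hint γ)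
    (fun γ _ => hMpos γ)
  intro β hβ β' hβ' hββ'
  simp only [u1IdentityFlow_meanAccept_eq_ratio]
  exact h hβ hβ' hββ'

end U1

end Summit.Ventures.LatticeQCDFlow.Theory2
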